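import Summits.QuantumAdvantage.QuantumAdvantage.Theorems.LinnikCubicClassGroupsDegreeOnePrimesEscapeChebotarevElementRelative
import Summits.QuantumAdvantage.QuantumAdvantage.Theorems.LinnikCubicClassGroupsDegreeOnePrimesEscapeRamifiedJunk
import Literature.NumberTheory.GaloisRepresentations.FrobeniusDensityTheorem
import HarnessLib

/-!
# The least prime of `F` that splits completely in a Galois extension `N/F`, arbitrary base

Topic `Summits/QuantumAdvantage/QuantumAdvantage/Theorems`, cell B2b-1 (linnik-cubic), PART A (gen 16); helper
toward the crux `DegreeOnePrimesEscape` (stmt-QuantumAdvantage-11543).  HONEST FRAMING: the value of this file is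
a THEOREM (kernel-checked, GRH-free) — NOT summit progress.

The case `σ = 1` of the Lagarias–Montgomery–Odlyzko theorem over an arbitrary base
(`exists_prime_isArithFrobAt_le_relative_discr_rpow`, `…ChebotarevElementRelative.lean`):

**Theorem** (`exists_mem_splitPrimes_absNorm_le_relative`).  For `n > 1` there is `L = L(n) > 0` such that for every
tower `ℚ ⊆ F ⊆ N` of number fields with `N/F` Galois and `[N:ℚ] = n` there is a prime `𝔮` of `F` that SPLITS
COMPLETELY in `N` (unramified, all residue degrees one: `splitPrimes F N` of `FrobeniusDensityTheorem.lean`), of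
degree one over `ℚ` (`N𝔮 = p` prime, `p ∤ d_N`), with `N𝔮 ≤ |d_N|^{L}`.  The tree's `…LeastSplitPrime.lean` (gen B-6) is
the case of a Galois `N/ℚ`.  [LagariasMontgomeryOdlyzko1979, Theorem 1.1 with `C = {1}`].
-/

noncomputable section

open NumberField IsDedekindDomain Ideal
open scoped NumberField Classical

namespace Summit.QuantumAdvantage.QuantumAdvantage.Theorems.DegreeOnePrimesEscape

open Literature.NumberTheory.LFunctions Literature.NumberTheory.GaloisRepresentations

/-- **The identity is a Frobenius at `𝔔` iff `f(𝔔 | 𝔔 ∩ 𝓞_F) = 1`** (one direction): if `x ≡ x^{N𝔮} (mod 𝔔)` for all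
`x ∈ 𝓞_N`, `𝔮 = 𝔔 ∩ 𝓞_F`, then the residue degree of `𝔔` over `𝔮` is one. [folklore] -/
theorem inertiaDeg_eq_one_of_isArithFrobAt_one {F N : Type} [Field F] [NumberField F] [Field N] [NumberField N]
    [Algebra F N] {Q : Ideal (𝓞 N)} [Q.IsMaximal] (h : IsArithFrobAt (𝓞 F) (1 : N ≃ₐ[F] N) Q) :
    Q.inertiaDeg (𝓞 F) = 1 := by
  haveI : (Q.under (𝓞 F)).IsMaximal := Ideal.IsMaximal.under (𝓞 F) Q
  haveI : Q.LiesOver (Q.under (𝓞 F)) := ⟨rfl⟩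
  have hq0 : Q.under (𝓞 F) ≠ ⊥ := by
    intro h0
    have hQ0 : Q ≠ ⊥ := Ideal.IsMaximal.ne_bot_of_isIntegral_int Q
    exact hQ0 (Ideal.eq_bot_of_comap_eq_bot h0)
  haveI : Finite (𝓞 F ⧸ Q.under (𝓞 F)) := Ideal.finiteQuotientOfFreeOfNeBot _ hq0
  have hq1 : 1 < Nat.card (𝓞 F ⧸ Q.under (𝓞 F)) := by
    rw [← Submodule.cardQuot_apply, ← Ideal.absNorm_apply]
    exact NumberField.HeightOneSpectrum.one_lt_absNorm ⟨Q.under (𝓞 F), inferInstance, hq0⟩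
  refine inertiaDeg_eq_one_of_forall_pow_sub_mem' (Q.under (𝓞 F)) Q hq1 fun y => ?_
  have h1 := h y
  rw [MulSemiringAction.toAlgHom_apply, one_smul] at h1
  rw [← Ideal.neg_mem_iff, neg_sub]
  exact h1

/-- **The least prime of the base splitting completely in a Galois extension** (see the module docstring).
[cite: LagariasMontgomeryOdlyzko1979, Theorem 1.1] -/
theorem exists_mem_splitPrimes_absNorm_le_relative (n : ℕ) (hn : 1 < n) :
    ∃ L : ℝ, 0 < L ∧ ∀ (F N : Type) [Field F] [NumberField F] [Field N] [NumberField N] [Algebra F N]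
      [IsGalois F N], Module.finrank ℚ N = n →
        ∃ q : HeightOneSpectrum (𝓞 F), q ∈ splitPrimes F N ∧ (Ideal.absNorm q.asIdeal).Prime ∧
          ¬ ((Ideal.absNorm q.asIdeal : ℤ) ∣ NumberField.discr N) ∧
          (Ideal.absNorm q.asIdeal : ℝ) ≤ ((NumberField.discr N).natAbs : ℝ) ^ L := by
  obtain ⟨L, hL, hmain⟩ := exists_prime_isArithFrobAt_le_relative_discr_rpow n hn
  refine ⟨L, hL, fun F N _ _ _ _ _ _ hNn ↦ ?_⟩
  obtain ⟨Q, hQmax, hfrob, -, -, hprime, hnd, hle⟩ := hmain F N hNn 1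
  haveI := hQmax
  have hq0 : Q.under (𝓞 F) ≠ ⊥ := by
    intro h0
    rw [h0, Ideal.absNorm_bot] at hprime
    exact Nat.not_prime_zero hprime
  set q : HeightOneSpectrum (𝓞 F) := ⟨Q.under (𝓞 F), Ideal.IsPrime.under (𝓞 F) Q, hq0⟩ with hq
  have hQmem : Q ∈ q.asIdeal.primesOver (𝓞 N) := ⟨hQmax.isPrime, ⟨rfl⟩⟩
  -- unramified: `p ∤ d_N`
  have hunr : Algebra.IsUnramifiedIn (𝓞 N) q.asIdeal := by
    by_contra hram
    have hpq : ((Ideal.absNorm (Q.under (𝓞 F)) : ℕ) : 𝓞 F) ∈ q.asIdeal := Ideal.absNorm_mem _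
    exact hnd (dvd_discr_of_not_isUnramifiedIn (N := N) q hprime hpq hram)
  refine ⟨q, mem_splitPrimes_of_inertiaDeg_eq_one hunr hQmem (inertiaDeg_eq_one_of_isArithFrobAt_one hfrob),
    hprime, hnd, hle⟩

end Summit.QuantumAdvantage.QuantumAdvantage.Theorems.DegreeOnePrimesEscape

end
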